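import Summits.QuantumFields.YangMills.Theorems.FlatTubeReductionPinnedSpanStepSplit
import Summits.QuantumFields.YangMills.Theorems.FlatTubeReductionPinnedTubeRatioLawGroundMinMax
import Summits.QuantumFields.YangMills.Theorems.FemtoCutoffLadderDyadicNestedUpperDirichlet
import HarnessLib

/-!
# Route `FlatTubeReduction`, crux `PinnedUnitStepEx` (stmt-QuantumFields-27561), stub 2 `stub_pinnedAutocorrExTI1` —
# the ZERO-MOMENTUM CRITERION for its hidden existence conjunct (P1)

Seat leafhand-qf-flattubereduction-1 g0 (2026-08-30).  The registered hard stub `PinnedAutocorrExTI1` (skeleton «ti-split-1» v2,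
`Theorems/FlatTubeReductionPinnedUnitStepExDefs.lean`) is the conjunction of

* (P1) along the femto window there IS a coarse-TRANSLATION-INVARIANT normalised physical `secondValue′`-eigenfunction `φ′ ⊥ Ω′`
  («the first zero-flux excitation has a zero-momentum member» — memo `MOMENTUM-COVARIANT-ENGINE-fcl-p3-g11.md` on the item), and
* (P2) the one-slab two-cutoff autocorrelation comparison for its smeared trial (the XL wall; one-step door p644937).

This file settles the FIXED-LATTICE functional analysis behind (P1), for every `L ≥ 1` and every `β > 0`:

* `transferApply_avg`, `avg_eigen`: the translation average `F̄ = |Λ_L|⁻¹ Σ_v F∘τ_v` of a physical pointwise eigenfunction of `K_β` is a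
  translation-invariant physical pointwise eigenfunction with the SAME eigenvalue, and `⟨F̄, G⟩ = ⟨F, G⟩` for every translation-invariant
  physical `G` (`l2_avg_left_of_ti`); hence `exists_ti_eigen_of_l2_avg_pos`: an eigenfunction `⊥ Ω` with `‖F̄‖ ≠ 0` yields a NORMALISED
  translation-invariant eigenfunction `⊥ Ω` (same eigenvalue).
* ★ `exists_ti_secondEigen_of_separation` (the criterion): if some translation-invariant physical `ψ₀ ⊥ Ω` has a Rayleigh quotient STRICTLY
  above that of every physical `ψ ⊥ Ω` with vanishing translation average (`ψ̄ = 0`, "non-zero momentum"), then there is a translation-invariant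
  normalised physical `φ ⊥ Ω` with `K_β φ = λ₁ φ` pointwise, `λ₁ = secondValue`.  Proof: the attained second eigenfunction `e₁` (tree
  `exists_isPhys_eigenfamily_dominating_of_pos`) splits as `ē₁ + (e₁ − ē₁)`; if `‖ē₁‖ = 0` the remainder is a zero-average physical unit vector
  with `K_β`-quotient exactly `λ₁`, contradicting the separation and the min–max bound `⟨ψ₀,K_βψ₀⟩ ≤ λ₁‖ψ₀‖²`
  (`TubeMax.qform_le_levelValue_one_of_orth_ground`); otherwise normalise `ē₁`.
* `exists_ti_secondEigen_of_separation_inline`: the same with the stub's INLINE spellings (shift `U ↦ (e ↦ U (e.1 − v, e.2))`, eigen-equations as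
  `∀ U, ∫ K_β(U,V) φ(V) dV = λ φ(U)`).

So (P1) is EQUIVALENT, lattice by lattice, to a variational SEPARATION between the best zero-momentum excitation and all non-zero-momentum
zero-flux states — the form in which any spectral analysis of the femto window (Lüscher: non-zero momenta cost `O(2π)/L`, the zero-momentum
excitation `ε₁λ/L`) would deliver it.  HONEST FRAMING: fixed-lattice lemmas only; neither (P1) along the window nor (P2) is proved; R2b1 is a
RECORD rung; no stub, crux or summit is proved by this file.
References: M. Reed, B. Simon IV (1978) Thm XIII.1, XIII.43–44; M. Lüscher, Nucl. Phys. B219 (1983) §3; P. van Baal, hep-ph/0008206 p. 9.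
-/

set_option autoImplicit false

noncomputable section

namespace Summit.QuantumFields.YangMills.Theorems.FlatTubeReduction.ZeroMomentum

open MeasureTheory
open Literature.MathematicalPhysics.QuantumFieldTheory (Site Edge GaugeConfig gaugeTransform torusConfigShift torusConfigShift_apply)
open Summit.QuantumFields.YangMills.Theorems.FemtoTransferGap
open Summit.QuantumFields.YangMills.Theorems.FlatTubeReduction.PinnedSpan

variable {L : ℕ} [NeZero L]

/-! ## §1 Translation averages of physical test functions -/

/-- The number of sites of the torus is a positive real. [folklore] -/
theorem card_site_pos : (0 : ℝ) < (Fintype.card (Site 3 L) : ℝ) := by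
  exact_mod_cast Fintype.card_pos

/-- The translation average of a translation-invariant function is the function itself. [folklore] -/
theorem avg_eq_self_of_ti {F : GaugeConfig 3 L SU2 → ℝ}
    (hTI : ∀ (v : Site 3 L) (U : GaugeConfig 3 L SU2), F (torusConfigShift v U) = F U) (U : GaugeConfig 3 L SU2) :
    (Fintype.card (Site 3 L) : ℝ)⁻¹ * ∑ v : Site 3 L, F (torusConfigShift v U) = F U := by
  simp only [hTI, Finset.sum_const, Finset.card_univ, nsmul_eq_mul]
  rw [← mul_assoc, inv_mul_cancel₀ (card_site_pos (L := L)).ne', one_mul]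

/-- `l2` of a pointwise difference in the left slot (physical test functions). [folklore] -/
theorem l2_sub_left {f g h : GaugeConfig 3 L SU2 → ℝ} (hf : IsPhys f) (hg : IsPhys g) (hh : IsPhys h) :
    l2 (fun U => f U - g U) h = l2 f h - l2 g h := by
  unfold l2
  simp only [sub_mul]
  exact integral_sub (hf.integrable_mul hh) (hg.integrable_mul hh)

/-- **`K_β` commutes with the translation average** (pointwise): `K_β F̄ = (K_β F)‾` for physical `F`. [folklore] -/
theorem transferApply_avg (β : ℝ) {F : GaugeConfig 3 L SU2 → ℝ} (hF : IsPhys F) :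
    transferApply β (fun U => (Fintype.card (Site 3 L) : ℝ)⁻¹ * ∑ v : Site 3 L, F (torusConfigShift v U)) =
      fun U => (Fintype.card (Site 3 L) : ℝ)⁻¹ * ∑ v : Site 3 L, transferApply β F (torusConfigShift v U) := by
  funext U
  rw [transferApply_apply]
  have hint : ∀ v ∈ (Finset.univ : Finset (Site 3 L)),
      Integrable (fun V => (Fintype.card (Site 3 L) : ℝ)⁻¹ * (transferKernel su2Rep β U V * F (torusConfigShift v V)))
        (configMeasure SU2 L) := by
    intro v _
    obtain ⟨C, hC⟩ := (hF.comp_torusConfigShift v).bounded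
    exact (integrable_transferKernel_mul β U (hF.comp_torusConfigShift v).measurable hC).const_mul _
  have hsplit : (fun V => transferKernel su2Rep β U V * ((Fintype.card (Site 3 L) : ℝ)⁻¹ * ∑ v : Site 3 L, F (torusConfigShift v V))) =
      fun V => ∑ v : Site 3 L, (Fintype.card (Site 3 L) : ℝ)⁻¹ * (transferKernel su2Rep β U V * F (torusConfigShift v V)) := by
    funext V
    rw [Finset.mul_sum, Finset.mul_sum]
    exact Finset.sum_congr rfl fun v _ => by ring
  rw [hsplit, integral_finsetSum _ hint, Finset.mul_sum]
  refine Finset.sum_congr rfl fun v _ => ?_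
  rw [integral_const_mul]
  congr 1
  have h := congrFun (GroundStateUnique.transferApply_comp_torusConfigShift β v F) U
  rw [transferApply_apply] at h
  exact h

/-- **The translation average of a pointwise eigenfunction is a pointwise eigenfunction with the same eigenvalue.** [folklore] -/
theorem avg_eigen (β : ℝ) {mu : ℝ} {F : GaugeConfig 3 L SU2 → ℝ} (hF : IsPhys F) (heig : transferApply β F = mu • F) :
    transferApply β (fun U => (Fintype.card (Site 3 L) : ℝ)⁻¹ * ∑ v : Site 3 L, F (torusConfigShift v U)) =
      mu • fun U => (Fintype.card (Site 3 L) : ℝ)⁻¹ * ∑ v : Site 3 L, F (torusConfigShift v U) := by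
  rw [transferApply_avg β hF, heig]
  funext U
  simp only [Pi.smul_apply, smul_eq_mul, Finset.mul_sum]
  exact Finset.sum_congr rfl fun v _ => by ring

/-- **`⟨F̄, G⟩ = ⟨F, G⟩` for translation-invariant physical `G`** (each translate pairs with `G` like `F`). [folklore] -/
theorem l2_avg_left_of_ti {F G : GaugeConfig 3 L SU2 → ℝ} (hF : IsPhys F) (hG : IsPhys G)
    (hGTI : ∀ (v : Site 3 L) (U : GaugeConfig 3 L SU2), G (torusConfigShift v U) = G U) :
    l2 (fun U => (Fintype.card (Site 3 L) : ℝ)⁻¹ * ∑ v : Site 3 L, F (torusConfigShift v U)) G = l2 F G := by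
  have h0 := integral_ti_mul_sub_avg hG hF hGTI
  have hsub : l2 (fun U => F U - (Fintype.card (Site 3 L) : ℝ)⁻¹ * ∑ v : Site 3 L, F (torusConfigShift v U)) G = 0 := by
    unfold l2
    rw [← h0]
    exact integral_congr_ae (ae_of_all _ fun U => by ring)
  rw [l2_sub_left hF (isPhys_avg hF) hG] at hsub
  linarith

/-- `‖F̄‖² = ⟨F, F̄⟩`. [folklore] -/
theorem l2_avg_avg_eq {F : GaugeConfig 3 L SU2 → ℝ} (hF : IsPhys F) :
    l2 (fun U => (Fintype.card (Site 3 L) : ℝ)⁻¹ * ∑ v : Site 3 L, F (torusConfigShift v U))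
        (fun U => (Fintype.card (Site 3 L) : ℝ)⁻¹ * ∑ v : Site 3 L, F (torusConfigShift v U)) =
      l2 F (fun U => (Fintype.card (Site 3 L) : ℝ)⁻¹ * ∑ v : Site 3 L, F (torusConfigShift v U)) :=
  l2_avg_left_of_ti hF (isPhys_avg hF) (avg_torusConfigShift F)

/-! ## §2 From an eigenfunction with non-vanishing zero-momentum part to a translation-invariant normalised eigenfunction -/

/-- **Normalising the zero-momentum part.**  `F` physical with `K_β F = μ F` pointwise and `F ⊥ Ω` (`Ω` translation-invariant physical); if
`‖F̄‖² > 0` then `φ := F̄/‖F̄‖` is physical, translation invariant, `⊥ Ω`, normalised, and `K_β φ = μ φ` pointwise. [cite: ReedSimonIV1978, Thm. XIII.1] -/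
theorem exists_ti_eigen_of_l2_avg_pos (β : ℝ) {mu : ℝ} {F Ω : GaugeConfig 3 L SU2 → ℝ} (hF : IsPhys F)
    (heig : transferApply β F = mu • F) (hΩ : IsPhys Ω)
    (hΩTI : ∀ (v : Site 3 L) (U : GaugeConfig 3 L SU2), Ω (torusConfigShift v U) = Ω U) (horth : l2 F Ω = 0)
    (hpos : 0 < l2 (fun U => (Fintype.card (Site 3 L) : ℝ)⁻¹ * ∑ v : Site 3 L, F (torusConfigShift v U))
        (fun U => (Fintype.card (Site 3 L) : ℝ)⁻¹ * ∑ v : Site 3 L, F (torusConfigShift v U))) :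
    ∃ φ : GaugeConfig 3 L SU2 → ℝ, IsPhys φ ∧
      (∀ (v : Site 3 L) (U : GaugeConfig 3 L SU2), φ (torusConfigShift v U) = φ U) ∧
      l2 φ Ω = 0 ∧ l2 φ φ = 1 ∧ transferApply β φ = mu • φ := by
  set g : GaugeConfig 3 L SU2 → ℝ := fun U => (Fintype.card (Site 3 L) : ℝ)⁻¹ * ∑ v : Site 3 L, F (torusConfigShift v U) with hg
  have hgP : IsPhys g := isPhys_avg hF
  set n : ℝ := l2 g g with hn
  set a : ℝ := (Real.sqrt n)⁻¹ with ha
  have hsq : 0 < Real.sqrt n := Real.sqrt_pos.2 hpos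
  refine ⟨a • g, hgP.smul a, fun v U => ?_, ?_, ?_, ?_⟩
  · simp only [Pi.smul_apply, smul_eq_mul]
    rw [hg]
    simp only []
    rw [avg_torusConfigShift F v U]
  · rw [l2_smul_left, l2_avg_left_of_ti hF hΩ hΩTI, horth, mul_zero]
  · rw [l2_smul_left, l2_comm, l2_smul_left, ← hn]
    have h1 : a * a * n = 1 := by
      rw [ha, ← mul_inv, ← Real.sqrt_mul_self hpos.le]
      rw [Real.sqrt_mul_self hpos.le, Real.mul_self_sqrt hpos.le]
      exact inv_mul_cancel₀ hpos.ne'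
    calc a * (a * n) = a * a * n := by ring
      _ = 1 := h1
  · rw [transferApply_smul, avg_eigen β hF heig, smul_comm]

/-! ## §3 ★ The zero-momentum criterion for the first excitation -/

/-- ★ **Zero-momentum criterion.**  `β > 0`; `Ω` the physical, everywhere-positive, normalised, pointwise top eigenfunction of `K_β`.  Suppose a
translation-invariant physical `ψ₀ ⊥ Ω`, `‖ψ₀‖ > 0`, has Rayleigh quotient STRICTLY larger than that of every physical `ψ ⊥ Ω` of positive norm
whose translation average vanishes identically (cross-multiplied: `⟨ψ,K_βψ⟩‖ψ₀‖² < ⟨ψ₀,K_βψ₀⟩‖ψ‖²`).  Then there is a translation-invariant,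
normalised, physical `φ ⊥ Ω` with `K_β φ = λ₁ φ` pointwise, `λ₁ = secondValue su2Rep L β`: the first zero-flux excitation has a zero-momentum
member. [cite: ReedSimonIV1978, Thm. XIII.1] [cite: Luscher1983, §3] -/
theorem exists_ti_secondEigen_of_separation {β : ℝ} (hβ : 0 < β) {Ω : GaugeConfig 3 L SU2 → ℝ} (hΩ : IsPhys Ω)
    (hΩpos : ∀ U, 0 < Ω U) (hΩ1 : l2 Ω Ω = 1) (hΩeig : transferApply β Ω = topValue su2Rep L β • Ω)
    (hsep : ∃ ψ₀ : GaugeConfig 3 L SU2 → ℝ, IsPhys ψ₀ ∧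
      (∀ (v : Site 3 L) (U : GaugeConfig 3 L SU2), ψ₀ (torusConfigShift v U) = ψ₀ U) ∧ l2 ψ₀ Ω = 0 ∧ 0 < l2 ψ₀ ψ₀ ∧
      ∀ ψ : GaugeConfig 3 L SU2 → ℝ, IsPhys ψ →
        (∀ U, (Fintype.card (Site 3 L) : ℝ)⁻¹ * ∑ v : Site 3 L, ψ (torusConfigShift v U) = 0) →
        l2 ψ Ω = 0 → 0 < l2 ψ ψ → qform su2Rep β ψ ψ * l2 ψ₀ ψ₀ < qform su2Rep β ψ₀ ψ₀ * l2 ψ ψ) :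
    ∃ φ : GaugeConfig 3 L SU2 → ℝ, IsPhys φ ∧
      (∀ (v : Site 3 L) (U : GaugeConfig 3 L SU2), φ (torusConfigShift v U) = φ U) ∧
      l2 φ Ω = 0 ∧ l2 φ φ = 1 ∧ transferApply β φ = secondValue su2Rep L β • φ := by
  obtain ⟨ψ₀, hψ₀, hψ₀TI, hψ₀Ω, hψ₀pos, hsep⟩ := hsep
  -- the attained second eigenfunction
  obtain ⟨e, he, hon, heeig, -⟩ := exists_isPhys_eigenfamily_dominating_of_pos (L := L) hβ 1
  have he1 : IsPhys (e 1) := he 1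
  have hn1 : l2 (e 1) (e 1) = 1 := by rw [hon 1 1, if_pos rfl]
  have heig1 : transferApply β (e 1) = secondValue su2Rep L β • e 1 := by
    rw [heeig 1]
    simp [levelValue_one]
  have hgap : secondValue su2Rep L β < topValue su2Rep L β := PhysL2.secondValue_lt_topValue β
  have hΩTI : ∀ (v : Site 3 L) (U : GaugeConfig 3 L SU2), Ω (torusConfigShift v U) = Ω U := fun v U =>
    congrFun (GroundStateUnique.groundState_comp_torusConfigShift β hΩ hΩpos hΩ1 hΩeig v) U
  have horth1 : l2 (e 1) Ω = 0 := Dirichlet.l2_eq_zero_of_eigen_ne β he1 hΩ heig1 hΩeig hgap.ne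
  -- its zero-momentum part
  set g : GaugeConfig 3 L SU2 → ℝ := fun U => (Fintype.card (Site 3 L) : ℝ)⁻¹ * ∑ v : Site 3 L, e 1 (torusConfigShift v U) with hg
  have hgP : IsPhys g := isPhys_avg he1
  have hgTI : ∀ (v : Site 3 L) (U : GaugeConfig 3 L SU2), g (torusConfigShift v U) = g U := fun v U => avg_torusConfigShift (e 1) v U
  by_cases hgpos : 0 < l2 g g
  · exact exists_ti_eigen_of_l2_avg_pos β he1 heig1 hΩ hΩTI horth1 hgpos
  · exfalso
    have hg0 : l2 g g = 0 := le_antisymm (not_lt.1 hgpos) (l2_self_nonneg _)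
    -- pairings with `g` vanish
    have hge : l2 g (e 1) = 0 := by rw [l2_comm, ← l2_avg_avg_eq he1]; exact hg0
    have hgΩ : l2 g Ω = 0 := by rw [hg, l2_avg_left_of_ti he1 hΩ hΩTI]; exact horth1
    -- the non-zero-momentum remainder `ψ = e₁ − ē₁`
    set ψ : GaugeConfig 3 L SU2 → ℝ := fun U => e 1 U - g U with hψ
    have hψP : IsPhys ψ := isPhys_sub_avg he1
    have hψavg : ∀ U, (Fintype.card (Site 3 L) : ℝ)⁻¹ * ∑ v : Site 3 L, ψ (torusConfigShift v U) = 0 := by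
      intro U
      simp only [hψ, Finset.sum_sub_distrib, mul_sub, hgTI, Finset.sum_const, Finset.card_univ, nsmul_eq_mul]
      rw [← mul_assoc, inv_mul_cancel₀ (card_site_pos (L := L)).ne', one_mul]
      exact sub_self _
    have hψΩ : l2 ψ Ω = 0 := by
      rw [hψ, l2_sub_left he1 hgP hΩ, horth1, hgΩ, sub_zero]
    have hψ1 : l2 ψ ψ = 1 := by
      have h1 : l2 ψ (e 1) = 1 := by rw [hψ, l2_sub_left he1 hgP he1, hn1, hge, sub_zero]
      have h2 : l2 ψ g = 0 := by rw [hψ, l2_sub_left he1 hgP hgP, l2_comm, hge, hg0, sub_zero]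
      have h3 : l2 ψ ψ = l2 ψ (e 1) - l2 ψ g := by
        rw [l2_comm ψ ψ]
        conv_lhs => rw [hψ]
        rw [l2_sub_left he1 hgP hψP, l2_comm (e 1) ψ, l2_comm g ψ]
      rw [h3, h1, h2, sub_zero]
    have hψeig : transferApply β ψ = secondValue su2Rep L β • ψ := by
      have hdec : ψ = e 1 + (-1 : ℝ) • g := by
        funext U; simp [hψ, sub_eq_add_neg]
      rw [hdec, transferApply_add β he1 (hgP.smul (-1)), transferApply_smul, heig1, avg_eigen β he1 heig1, smul_comm,
        smul_add]
    have hq : qform su2Rep β ψ ψ = secondValue su2Rep L β := by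
      rw [OffTube.qform_eigen_right β hψeig, hψ1, mul_one]
    -- separation versus min–max
    have hlt := hsep ψ hψP hψavg hψΩ (by rw [hψ1]; exact one_pos)
    rw [hq, hψ1, mul_one] at hlt
    have hle : qform su2Rep β ψ₀ ψ₀ ≤ levelValue su2Rep L β 1 * l2 ψ₀ ψ₀ :=
      TubeMax.qform_le_levelValue_one_of_orth_ground hβ hΩ hΩpos hΩeig hψ₀ hψ₀Ω
    rw [levelValue_one] at hle
    linarith

/-- ★ **Zero-momentum criterion, inline spellings of the stub** (`Theorems/FlatTubeReductionPinnedUnitStepExDefs.lean`, conjuncts of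
`PinnedAutocorrExTI1`): shift written `U ↦ (e ↦ U (e.1 − v, e.2))`, eigen-equations written as kernel integrals.  Under the variational
separation hypothesis the (P1)-conjuncts of the stub hold at `(L, β)`. [cite: ReedSimonIV1978, Thm. XIII.1] [cite: Luscher1983, §3] -/
theorem exists_ti_secondEigen_of_separation_inline {β : ℝ} (hβ : 0 < β) {Ω : GaugeConfig 3 L SU2 → ℝ} (hΩ : IsPhys Ω)
    (hΩpos : ∀ U, 0 < Ω U) (hΩ1 : l2 Ω Ω = 1)
    (hΩeig : ∀ U, ∫ V, transferKernel su2Rep β U V * Ω V ∂(configMeasure SU2 L) = topValue su2Rep L β * Ω U)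
    (hsep : ∃ ψ₀ : GaugeConfig 3 L SU2 → ℝ, IsPhys ψ₀ ∧
      (∀ (v : Site 3 L) (U : GaugeConfig 3 L SU2), ψ₀ (fun e => U (e.1 - v, e.2)) = ψ₀ U) ∧ l2 ψ₀ Ω = 0 ∧ 0 < l2 ψ₀ ψ₀ ∧
      ∀ ψ : GaugeConfig 3 L SU2 → ℝ, IsPhys ψ →
        (∀ U : GaugeConfig 3 L SU2, (Fintype.card (Site 3 L) : ℝ)⁻¹ * ∑ v : Site 3 L, ψ (fun e => U (e.1 - v, e.2)) = 0) →
        l2 ψ Ω = 0 → 0 < l2 ψ ψ → qform su2Rep β ψ ψ * l2 ψ₀ ψ₀ < qform su2Rep β ψ₀ ψ₀ * l2 ψ ψ) :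
    ∃ φ : GaugeConfig 3 L SU2 → ℝ, IsPhys φ ∧
      (∀ (v : Site 3 L) (U : GaugeConfig 3 L SU2), φ (fun e => U (e.1 - v, e.2)) = φ U) ∧
      l2 φ Ω = 0 ∧ l2 φ φ = 1 ∧
      (∀ U, ∫ V, transferKernel su2Rep β U V * φ V ∂(configMeasure SU2 L) = secondValue su2Rep L β * φ U) := by
  have hshift : ∀ (v : Site 3 L) (U : GaugeConfig 3 L SU2), torusConfigShift v U = fun e => U (e.1 - v, e.2) :=
    fun v U => funext fun e => torusConfigShift_apply v U e
  have hΩeig' : transferApply β Ω = topValue su2Rep L β • Ω := by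
    funext U
    rw [transferApply_apply, hΩeig U, Pi.smul_apply, smul_eq_mul]
  obtain ⟨ψ₀, hψ₀, hψ₀TI, hψ₀Ω, hψ₀pos, hsep⟩ := hsep
  have hsep' : ∃ ψ₀ : GaugeConfig 3 L SU2 → ℝ, IsPhys ψ₀ ∧
      (∀ (v : Site 3 L) (U : GaugeConfig 3 L SU2), ψ₀ (torusConfigShift v U) = ψ₀ U) ∧ l2 ψ₀ Ω = 0 ∧ 0 < l2 ψ₀ ψ₀ ∧
      ∀ ψ : GaugeConfig 3 L SU2 → ℝ, IsPhys ψ →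
        (∀ U, (Fintype.card (Site 3 L) : ℝ)⁻¹ * ∑ v : Site 3 L, ψ (torusConfigShift v U) = 0) →
        l2 ψ Ω = 0 → 0 < l2 ψ ψ → qform su2Rep β ψ ψ * l2 ψ₀ ψ₀ < qform su2Rep β ψ₀ ψ₀ * l2 ψ ψ := by
    refine ⟨ψ₀, hψ₀, fun v U => by rw [hshift]; exact hψ₀TI v U, hψ₀Ω, hψ₀pos, fun ψ hψ havg => ?_⟩
    exact hsep ψ hψ fun U => by simpa only [hshift] using havg U
  obtain ⟨φ, hφ, hφTI, hφΩ, hφ1, hφeig⟩ := exists_ti_secondEigen_of_separation hβ hΩ hΩpos hΩ1 hΩeig' hsep'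
  refine ⟨φ, hφ, fun v U => by rw [← hshift]; exact hφTI v U, hφΩ, hφ1, fun U => ?_⟩
  have h := congrFun hφeig U
  rw [transferApply_apply, Pi.smul_apply, smul_eq_mul] at h
  exact h

end Summit.QuantumFields.YangMills.Theorems.FlatTubeReduction.ZeroMomentum

end

/-! ## §4 (appended) The momentum dichotomy for the first excitation and the spectral-bound criterion -/

noncomputable section

namespace Summit.QuantumFields.YangMills.Theorems.FlatTubeReduction.ZeroMomentum

open MeasureTheory
open Literature.MathematicalPhysics.QuantumFieldTheory (Site Edge GaugeConfig gaugeTransform torusConfigShift torusConfigShift_apply)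
open Summit.QuantumFields.YangMills.Theorems.FemtoTransferGap
open Summit.QuantumFields.YangMills.Theorems.FlatTubeReduction.PinnedSpan

variable {L : ℕ} [NeZero L]

/-- ★ **Momentum dichotomy for the first zero-flux excitation.**  `β > 0`; `Ω` the physical, everywhere-positive, normalised, pointwise top
eigenfunction of `K_β`.  EITHER there is a translation-invariant normalised physical `φ ⊥ Ω` with `K_β φ = λ₁ φ` pointwise (`λ₁ = secondValue`:
the first excitation has a zero-momentum member), OR there is a normalised physical `ψ ⊥ Ω` with IDENTICALLY VANISHING translation average and
`K_β ψ = λ₁ ψ` pointwise (a purely non-zero-momentum first excitation).  (The attained second eigenfunction `e₁` splits as `ē₁ + (e₁ − ē₁)`.)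
[cite: ReedSimonIV1978, Thm. XIII.1] [cite: Luscher1983, §3] -/
theorem exists_ti_secondEigen_or_zeroAvg_secondEigen {β : ℝ} (hβ : 0 < β) {Ω : GaugeConfig 3 L SU2 → ℝ} (hΩ : IsPhys Ω)
    (hΩpos : ∀ U, 0 < Ω U) (hΩ1 : l2 Ω Ω = 1) (hΩeig : transferApply β Ω = topValue su2Rep L β • Ω) :
    (∃ φ : GaugeConfig 3 L SU2 → ℝ, IsPhys φ ∧
      (∀ (v : Site 3 L) (U : GaugeConfig 3 L SU2), φ (torusConfigShift v U) = φ U) ∧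
      l2 φ Ω = 0 ∧ l2 φ φ = 1 ∧ transferApply β φ = secondValue su2Rep L β • φ) ∨
    (∃ ψ : GaugeConfig 3 L SU2 → ℝ, IsPhys ψ ∧
      (∀ U, (Fintype.card (Site 3 L) : ℝ)⁻¹ * ∑ v : Site 3 L, ψ (torusConfigShift v U) = 0) ∧
      l2 ψ Ω = 0 ∧ l2 ψ ψ = 1 ∧ transferApply β ψ = secondValue su2Rep L β • ψ) := by
  -- the attained second eigenfunction
  obtain ⟨e, he, hon, heeig, -⟩ := exists_isPhys_eigenfamily_dominating_of_pos (L := L) hβ 1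
  have he1 : IsPhys (e 1) := he 1
  have hn1 : l2 (e 1) (e 1) = 1 := by rw [hon 1 1, if_pos rfl]
  have heig1 : transferApply β (e 1) = secondValue su2Rep L β • e 1 := by
    rw [heeig 1]
    simp [levelValue_one]
  have hgap : secondValue su2Rep L β < topValue su2Rep L β := PhysL2.secondValue_lt_topValue β
  have hΩTI : ∀ (v : Site 3 L) (U : GaugeConfig 3 L SU2), Ω (torusConfigShift v U) = Ω U := fun v U =>
    congrFun (GroundStateUnique.groundState_comp_torusConfigShift β hΩ hΩpos hΩ1 hΩeig v) U
  have horth1 : l2 (e 1) Ω = 0 := Dirichlet.l2_eq_zero_of_eigen_ne β he1 hΩ heig1 hΩeig hgap.ne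
  -- its zero-momentum part
  set g : GaugeConfig 3 L SU2 → ℝ := fun U => (Fintype.card (Site 3 L) : ℝ)⁻¹ * ∑ v : Site 3 L, e 1 (torusConfigShift v U) with hg
  have hgP : IsPhys g := isPhys_avg he1
  have hgTI : ∀ (v : Site 3 L) (U : GaugeConfig 3 L SU2), g (torusConfigShift v U) = g U := fun v U =>
    avg_torusConfigShift (e 1) v U
  by_cases hgpos : 0 < l2 g g
  · exact Or.inl (exists_ti_eigen_of_l2_avg_pos β he1 heig1 hΩ hΩTI horth1 hgpos)
  · right
    have hg0 : l2 g g = 0 := le_antisymm (not_lt.1 hgpos) (l2_self_nonneg _)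
    have hge : l2 g (e 1) = 0 := by rw [l2_comm, ← l2_avg_avg_eq he1]; exact hg0
    have hgΩ : l2 g Ω = 0 := by rw [hg, l2_avg_left_of_ti he1 hΩ hΩTI]; exact horth1
    set ψ : GaugeConfig 3 L SU2 → ℝ := fun U => e 1 U - g U with hψ
    have hψP : IsPhys ψ := isPhys_sub_avg he1
    refine ⟨ψ, hψP, fun U => ?_, ?_, ?_, ?_⟩
    · simp only [hψ, Finset.sum_sub_distrib, mul_sub, hgTI, Finset.sum_const, Finset.card_univ, nsmul_eq_mul]
      rw [← mul_assoc, inv_mul_cancel₀ (card_site_pos (L := L)).ne', one_mul]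
      exact sub_self _
    · rw [hψ, l2_sub_left he1 hgP hΩ, horth1, hgΩ, sub_zero]
    · have h1 : l2 ψ (e 1) = 1 := by rw [hψ, l2_sub_left he1 hgP he1, hn1, hge, sub_zero]
      have h2 : l2 ψ g = 0 := by rw [hψ, l2_sub_left he1 hgP hgP, l2_comm, hge, hg0, sub_zero]
      have h3 : l2 ψ ψ = l2 ψ (e 1) - l2 ψ g := by
        rw [l2_comm ψ ψ]
        conv_lhs => rw [hψ]
        rw [l2_sub_left he1 hgP hψP, l2_comm (e 1) ψ, l2_comm g ψ]
      rw [h3, h1, h2, sub_zero]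
    · have hdec : ψ = e 1 + (-1 : ℝ) • g := by
        funext U; simp [hψ, sub_eq_add_neg]
      rw [hdec, transferApply_add β he1 (hgP.smul (-1)), transferApply_smul, heig1, avg_eigen β he1 heig1, smul_comm,
        smul_add]

/-- ★ **Spectral-bound criterion.**  `β > 0`, `Ω` the ground state as above.  If the physical states `⊥ Ω` with identically vanishing
translation average (non-zero momentum) satisfy `⟨ψ, K_β ψ⟩ ≤ θ‖ψ‖²` for some `θ < λ₁ = secondValue`, then the first excitation has a
zero-momentum member: a translation-invariant normalised physical `φ ⊥ Ω` with `K_β φ = λ₁ φ` pointwise.  This is (P1) in the form a spectral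
analysis of the femto window delivers it (non-zero momenta cost `O(2π)/L`, the zero-momentum excitation `ε₁λ/L`).
[cite: ReedSimonIV1978, Thm. XIII.1] [cite: Luscher1983, §3] -/
theorem exists_ti_secondEigen_of_zeroAvg_bound {β : ℝ} (hβ : 0 < β) {Ω : GaugeConfig 3 L SU2 → ℝ} (hΩ : IsPhys Ω)
    (hΩpos : ∀ U, 0 < Ω U) (hΩ1 : l2 Ω Ω = 1) (hΩeig : transferApply β Ω = topValue su2Rep L β • Ω) {θ : ℝ}
    (hθ : θ < secondValue su2Rep L β)
    (hbd : ∀ ψ : GaugeConfig 3 L SU2 → ℝ, IsPhys ψ →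
      (∀ U, (Fintype.card (Site 3 L) : ℝ)⁻¹ * ∑ v : Site 3 L, ψ (torusConfigShift v U) = 0) →
      l2 ψ Ω = 0 → qform su2Rep β ψ ψ ≤ θ * l2 ψ ψ) :
    ∃ φ : GaugeConfig 3 L SU2 → ℝ, IsPhys φ ∧
      (∀ (v : Site 3 L) (U : GaugeConfig 3 L SU2), φ (torusConfigShift v U) = φ U) ∧
      l2 φ Ω = 0 ∧ l2 φ φ = 1 ∧ transferApply β φ = secondValue su2Rep L β • φ := by
  rcases exists_ti_secondEigen_or_zeroAvg_secondEigen hβ hΩ hΩpos hΩ1 hΩeig with h | ⟨ψ, hψ, havg, hψΩ, hψ1, hψeig⟩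
  · exact h
  · exfalso
    have hq : qform su2Rep β ψ ψ = secondValue su2Rep L β := by
      rw [OffTube.qform_eigen_right β hψeig, hψ1, mul_one]
    have h := hbd ψ hψ havg hψΩ
    rw [hq, hψ1, mul_one] at h
    exact absurd h (not_le.2 hθ)

/-- ★ **Spectral-bound criterion, inline spellings of the stub** (shift `U ↦ (e ↦ U (e.1 − v, e.2))`, eigen-equations as kernel integrals).
[cite: ReedSimonIV1978, Thm. XIII.1] [cite: Luscher1983, §3] -/
theorem exists_ti_secondEigen_of_zeroAvg_bound_inline {β : ℝ} (hβ : 0 < β) {Ω : GaugeConfig 3 L SU2 → ℝ} (hΩ : IsPhys Ω)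
    (hΩpos : ∀ U, 0 < Ω U) (hΩ1 : l2 Ω Ω = 1)
    (hΩeig : ∀ U, ∫ V, transferKernel su2Rep β U V * Ω V ∂(configMeasure SU2 L) = topValue su2Rep L β * Ω U) {θ : ℝ}
    (hθ : θ < secondValue su2Rep L β)
    (hbd : ∀ ψ : GaugeConfig 3 L SU2 → ℝ, IsPhys ψ →
      (∀ U : GaugeConfig 3 L SU2, (Fintype.card (Site 3 L) : ℝ)⁻¹ * ∑ v : Site 3 L, ψ (fun e => U (e.1 - v, e.2)) = 0) →
      l2 ψ Ω = 0 → qform su2Rep β ψ ψ ≤ θ * l2 ψ ψ) :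
    ∃ φ : GaugeConfig 3 L SU2 → ℝ, IsPhys φ ∧
      (∀ (v : Site 3 L) (U : GaugeConfig 3 L SU2), φ (fun e => U (e.1 - v, e.2)) = φ U) ∧
      l2 φ Ω = 0 ∧ l2 φ φ = 1 ∧
      (∀ U, ∫ V, transferKernel su2Rep β U V * φ V ∂(configMeasure SU2 L) = secondValue su2Rep L β * φ U) := by
  have hshift : ∀ (v : Site 3 L) (U : GaugeConfig 3 L SU2), torusConfigShift v U = fun e => U (e.1 - v, e.2) :=
    fun v U => funext fun e => torusConfigShift_apply v U e
  have hΩeig' : transferApply β Ω = topValue su2Rep L β • Ω := by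
    funext U
    rw [transferApply_apply, hΩeig U, Pi.smul_apply, smul_eq_mul]
  have hbd' : ∀ ψ : GaugeConfig 3 L SU2 → ℝ, IsPhys ψ →
      (∀ U, (Fintype.card (Site 3 L) : ℝ)⁻¹ * ∑ v : Site 3 L, ψ (torusConfigShift v U) = 0) →
      l2 ψ Ω = 0 → qform su2Rep β ψ ψ ≤ θ * l2 ψ ψ :=
    fun ψ hψ havg => hbd ψ hψ fun U => by simpa only [hshift] using havg U
  obtain ⟨φ, hφ, hφTI, hφΩ, hφ1, hφeig⟩ := exists_ti_secondEigen_of_zeroAvg_bound hβ hΩ hΩpos hΩ1 hΩeig' hθ hbd'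
  refine ⟨φ, hφ, fun v U => by rw [← hshift]; exact hφTI v U, hφΩ, hφ1, fun U => ?_⟩
  have h := congrFun hφeig U
  rw [transferApply_apply, Pi.smul_apply, smul_eq_mul] at h
  exact h

end Summit.QuantumFields.YangMills.Theorems.FlatTubeReduction.ZeroMomentum

end
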